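import Mathlib
import Literature.Topology.FourManifolds.PlanarAchiralWords
import Summits.SmoothPoincare4.SmoothPoincare4.Theorems.ConvexBisectionPlanarAcyclicBisectionRigidityHelperSeamNG
import HarnessLib

/-!
# Crux `ConvexBisection.PlanarAcyclicBisectionRigidity`, line Sketch (skeleton v2.0) — helper
# `helper_reachable_monodromy_eq`

Pure algebra on the definitions of `Literature/Topology/FourManifolds/PlanarAchiralWords.lean`
(arc data `ArcData n` of `Mod(D_n, ∂)`, `evalWord`, `monodromy`, `blockForm`, the five moves `Move`
and the orbit relation `Reachable`), reusing the `ArcData` monoid laws of `…StubWalkLow`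
(sub-namespace `WalkLow`: `mul_assoc'`, `one_mul'`, `mul_one'`, `evalWord_append`, `invWord_append`,
`twist_below`) and the on-the-nose inverse pairs of `…HelperSeamNG` (`SeamNG.evalWord_mul_invWord`).

* THE TOTAL MONODROMY IS AN ORBIT INVARIANT.  `ArcData n` is a monoid on the nose
  (`ReachMon.instMonoid`) and the arc data of a word `g` is a unit with two-sided
  inverse the arc data of its formal inverse `g⁻¹` (`ReachMon.U`); so the monodromy of a signed word
  is a product of units `T_l` (`ReachMon.T`, `ReachMon.M`) in the GROUP `(ArcData n)ˣ`, where the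
  bookkeeping of the moves is literal: rotation `T_l · M = 1 ↔ M · T_l = 1`; the signed Hurwitz move
  replaces `T_x T_y` by `(T_x T_y T_x⁻¹) T_x`, its inverse by `T_y (T_y⁻¹ T_x T_y)`
  (`ReachMon.T_hurwitzAct`, `ReachMon.T_not`: the negative twist word is the formal inverse of the
  positive one); global conjugation by `g` conjugates the total monodromy by the unit of `g`
  (`ReachMon.M_map_image`); planar stabilisation prepends the cancelling pair `T_γ T_γ⁻¹` after
  re-reading the old letters one level up.
* THE LEVEL EMBEDDING `ι : ArcData n → ArcData (n + 1)` (`ReachMon.lift`: the permutation extended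
  by fixing the new last hole, the arc words pushed along `Fin.castSucc`, new arc word `1`) is an
  injective monoid map (`lift_one`, `lift_mul`, `lift_injective`) that re-reads every generator
  supported below the new hole (`ReachMon.data_succ`, `blockWord_succ`), hence every twist word of
  an in-range curve (`WalkLow.twist_below`): `monodromy (n+1) w = ι (monodromy n w)` for in-range
  `w`, so "total monodromy `= 1`" survives (de)stabilisation (`monodromy_succ_eq_one_iff`).
* CONCLUSION (`helper_reachable_monodromy_eq`): the block form `A · B̄ʳᵉᵛ` has total monodromy
  `φ_A · φ_B⁻¹` (`ReachMon.M_blockForm`), `= 1` for an integral homotopy-sphere word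
  (`monodromy_eq`); the invariant propagates along `Reachable` (moves in either direction,
  `ReachMon.reachable_iff`); at a reachable block form `φ_{A'} · φ_{B'}⁻¹ = 1`, i.e. the two blocks
  again factorise one mapping class.  Uses nothing unproved.
-/

noncomputable section

open Literature.Topology.FourManifolds Literature.Topology.FourManifolds.PlanarWords

-- the prescribed namespace `Summit.<S>.<P>.…` repeats `SmoothPoincare4` (S = P = SmoothPoincare4)
set_option linter.dupNamespace false

namespace Summit.SmoothPoincare4.SmoothPoincare4.Theorems.PlanarAcyclicBisectionRigidity.Sketch

namespace ReachMon

open ArcData PGen FreeGroup WalkLow SeamNG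

variable {n : ℕ}

/-! ## `ArcData n` as a monoid; words evaluate to units -/

/-- `ArcData n` with `ArcData.mul`/`ArcData.one` is a monoid on the nose (laws from `WalkLow`;
`φ * ψ = ArcData.mul φ ψ` and `1 = ArcData.one` definitionally); registered to borrow Mathlib's
group-of-units algebra (`ArcData` carries no algebraic instance in the Literature file, so nothing
is overridden). [folklore] -/
instance instMonoid : Monoid (ArcData n) where
  mul := mul
  one := one
  mul_assoc := mul_assoc'
  one_mul := one_mul'
  mul_one := mul_one'

/-- `g⁻¹ · g = 1` as arc data, for every word `g` (from `SeamNG.evalWord_mul_invWord` applied to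
`g⁻¹` and `(g⁻¹)⁻¹ = g`). [folklore] -/
theorem evalWord_invWord_mul (g : List PGen) :
    mul (evalWord n (invWord g)) (evalWord n g) = one := by
  simpa only [invWord_invWord] using evalWord_mul_invWord (n := n) (invWord g)

/-- The arc data of a word `g` as a UNIT of the monoid `ArcData n`, with inverse the arc data of the
formal inverse word `g⁻¹`. [folklore] -/
def U (n : ℕ) (g : List PGen) : (ArcData n)ˣ :=
  ⟨evalWord n g, evalWord n (invWord g), evalWord_mul_invWord g, evalWord_invWord_mul g⟩

/-- `U` is multiplicative (`WalkLow.evalWord_append`). [folklore] -/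
theorem U_append (g h : List PGen) : U n (g ++ h) = U n g * U n h := Units.ext (evalWord_append g h)

/-- The formal inverse word evaluates to the inverse unit (definitional). [folklore] -/
theorem U_invWord (g : List PGen) : U n (invWord g) = (U n g)⁻¹ := Units.ext rfl

/-- The negative twist word of a curve is the formal inverse of the positive one:
`(g T_[a,b]^{∓} g⁻¹)⁻¹ = g T_[a,b]^{±} g⁻¹`. [folklore] -/
theorem invWord_twistWord (c : PlanarCurve) (s : Bool) :
    invWord (c.twistWord s) = c.twistWord (!s) := by
  simp [PlanarCurve.twistWord, invWord_append, invWord_invWord, PGen.inv]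

/-- The twist `T_l` of a signed letter as a unit. [folklore] -/
def T (n : ℕ) (l : Letter) : (ArcData n)ˣ := U n l.twistWord

/-- The total monodromy of a signed word as a unit. [folklore] -/
def M (n : ℕ) (w : List Letter) : (ArcData n)ˣ := U n (w.flatMap Letter.twistWord)

/-- The underlying arc data of `M n w` is `monodromy n w` (definitional). [folklore] -/
theorem M_val (w : List Letter) : ((M n w : (ArcData n)ˣ) : ArcData n) = monodromy n w := rfl

/-- Total monodromy of the empty word. [folklore] -/
theorem M_nil : M n [] = 1 := Units.ext rfl

/-- Total monodromy of a cons: `M(l :: w) = T_l · M(w)`. [folklore] -/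
theorem M_cons (l : Letter) (w : List Letter) : M n (l :: w) = T n l * M n w := by
  unfold M T
  rw [List.flatMap_cons, U_append]

/-- Total monodromy of a concatenation. [folklore] -/
theorem M_append (v w : List Letter) : M n (v ++ w) = M n v * M n w := by
  unfold M
  rw [List.flatMap_append, U_append]

/-- "Total monodromy `= 1`" read in the group of units. [folklore] -/
theorem monodromy_eq_one_iff (w : List Letter) : monodromy n w = one ↔ M n w = 1 :=
  Units.val_eq_one (a := M n w)

/-- Flipping the sign of a letter inverts its twist unit. [folklore] -/
theorem T_not (c : PlanarCurve) (s : Bool) : T n (c, !s) = (T n (c, s))⁻¹ := by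
  simp only [T, Letter.twistWord]
  rw [← invWord_twistWord, U_invWord]

/-- The negative twist unit is the inverse of the positive one. [folklore] -/
theorem T_false (c : PlanarCurve) : T n (c, false) = (T n (c, true))⁻¹ := T_not c true

/-- The twist of an image curve `h(c)` is the conjugate `h · T_c · h⁻¹`. [folklore] -/
theorem T_image (h : List PGen) (c : PlanarCurve) (s : Bool) :
    T n (PlanarCurve.image h c, s) = U n h * T n (c, s) * (U n h)⁻¹ := by
  simp only [T, Letter.twistWord, PlanarCurve.twistWord, PlanarCurve.image, invWord_append,
    List.append_assoc, U_append, U_invWord, mul_assoc]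

/-- The twist of the Hurwitz image `T_x^{±}(y)` is `T_x T_y T_x⁻¹`. [folklore] -/
theorem T_hurwitzAct (x y : Letter) : T n (hurwitzAct x y) = T n x * T n y * (T n x)⁻¹ := by
  obtain ⟨d, s⟩ := y
  exact T_image _ d s

/-- Global conjugation by `g` conjugates the total monodromy by the unit of `g`. [folklore] -/
theorem M_map_image (g : List PGen) (w : List Letter) :
    M n (w.map fun l => (PlanarCurve.image g l.1, l.2)) = U n g * M n w * (U n g)⁻¹ := by
  induction w with
  | nil => simp [M_nil]
  | cons l w ih =>
    obtain ⟨c, s⟩ := l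
    simp only [List.map_cons, M_cons, ih, T_image]
    group

/-- A positive factorisation, cons (definitional). [folklore] -/
theorem positiveWord_cons (c : PlanarCurve) (B : List PlanarCurve) :
    positiveWord (c :: B) = (c, true) :: positiveWord B := rfl

/-- The negative letters of `B` read backwards have total monodromy `φ_B⁻¹`. [folklore] -/
theorem M_negRev (B : List PlanarCurve) :
    M n ((B.map fun c => (c, false)).reverse) = (M n (positiveWord B))⁻¹ := by
  induction B with
  | nil => simp [M_nil, positiveWord]
  | cons c B ih =>
    rw [List.map_cons, List.reverse_cons, M_append, ih, positiveWord_cons, M_cons, M_cons, M_nil,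
      mul_one, T_false, mul_inv_rev]

/-- The block form `A · B̄ʳᵉᵛ` has total monodromy `φ_A · φ_B⁻¹`. [folklore] -/
theorem M_blockForm (A B : List PlanarCurve) :
    M n (blockForm A B) = M n (positiveWord A) * (M n (positiveWord B))⁻¹ := by
  rw [blockForm, M_append, M_negRev]

/-- The block form has total monodromy `1` iff the two blocks factorise the same mapping class.
[folklore] -/
theorem blockForm_one_iff (A B : List PlanarCurve) :
    monodromy n (blockForm A B) = one ↔
      monodromy n (positiveWord A) = monodromy n (positiveWord B) := by
  rw [monodromy_eq_one_iff, M_blockForm, mul_inv_eq_one, ← Units.val_inj, M_val, M_val]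

/-! ## The level embedding `ArcData n → ArcData (n + 1)` (new last hole fixed, arc word `1`) -/

/-- Extend a permutation of the holes `0 … n-1` to `n + 1` holes by fixing the new hole `n`.
[folklore] -/
def liftPerm (π : Equiv.Perm (Fin n)) : Equiv.Perm (Fin (n + 1)) where
  toFun := Fin.snoc (α := fun _ => Fin (n + 1)) (fun j => Fin.castSucc (π j)) (Fin.last n)
  invFun := Fin.snoc (α := fun _ => Fin (n + 1)) (fun j => Fin.castSucc (π.symm j)) (Fin.last n)
  left_inv i := by cases i using Fin.lastCases <;> simp
  right_inv i := by cases i using Fin.lastCases <;> simp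

/-- THE LEVEL EMBEDDING: the same mapping class on the disc with one more hole `n` added away from
its support (permutation extended by fixing `n`, arc words pushed along `Fin.castSucc`, `u_n = 1`).
[folklore] -/
def lift (φ : ArcData n) : ArcData (n + 1) where
  perm := liftPerm φ.perm
  u := Fin.snoc (α := fun _ => FreeGroup (Fin (n + 1)))
    (fun j => FreeGroup.map Fin.castSucc (φ.u j)) 1

/-- The lifted permutation on an old hole. [folklore] -/
@[simp] theorem lift_perm_castSucc (φ : ArcData n) (j : Fin n) :
    (lift φ).perm (Fin.castSucc j) = Fin.castSucc (φ.perm j) := by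
  simp [lift, liftPerm]

/-- The lifted permutation fixes the new hole. [folklore] -/
@[simp] theorem lift_perm_last (φ : ArcData n) : (lift φ).perm (Fin.last n) = Fin.last n := by
  simp [lift, liftPerm]

/-- The lifted arc word of an old hole. [folklore] -/
@[simp] theorem lift_u_castSucc (φ : ArcData n) (j : Fin n) :
    (lift φ).u (Fin.castSucc j) = FreeGroup.map Fin.castSucc (φ.u j) := by
  simp [lift]

/-- The lifted arc word of the new hole is trivial. [folklore] -/
@[simp] theorem lift_u_last (φ : ArcData n) : (lift φ).u (Fin.last n) = 1 := by
  simp [lift]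

/-- The lift intertwines the induced automorphisms along `F_n ↪ F_{n+1}`. [folklore] -/
theorem lift_aut_comp (φ : ArcData n) :
    (lift φ).aut.comp (FreeGroup.map Fin.castSucc) = (FreeGroup.map Fin.castSucc).comp φ.aut := by
  ext j
  simp [aut_of, FreeGroup.map.of]

/-- `(ι φ)_* (x) = φ_* (x)` for `x ∈ F_n ↪ F_{n+1}`. [folklore] -/
theorem lift_aut (φ : ArcData n) (x : FreeGroup (Fin n)) :
    (lift φ).aut (FreeGroup.map Fin.castSucc x) = FreeGroup.map Fin.castSucc (φ.aut x) :=
  DFunLike.congr_fun (lift_aut_comp φ) x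

/-- The lift of the identity is the identity. [folklore] -/
theorem lift_one : lift (one : ArcData n) = one := by
  refine ext' ?_ fun i => ?_
  · ext i
    cases i using Fin.lastCases <;> simp
  · cases i using Fin.lastCases <;> simp

/-- The lift is multiplicative. [folklore] -/
theorem lift_mul (φ ψ : ArcData n) : lift (mul φ ψ) = mul (lift φ) (lift ψ) := by
  refine ext' ?_ fun i => ?_
  · ext i
    cases i using Fin.lastCases <;> simp [Equiv.Perm.mul_apply]
  · cases i using Fin.lastCases <;> simp [lift_aut]

/-- The lift is injective (`Fin.castSucc` and `FreeGroup.map Fin.castSucc` are). [folklore] -/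
theorem lift_injective : Function.Injective (lift : ArcData n → ArcData (n + 1)) := by
  intro φ ψ h
  refine ext' (Equiv.ext fun j => ?_) fun j => ?_
  · have e := congrArg (fun χ : ArcData (n + 1) => χ.perm (Fin.castSucc j)) h
    simpa [Fin.castSucc_inj] using e
  · have e := congrArg (fun χ : ArcData (n + 1) => χ.u (Fin.castSucc j)) h
    simp only [lift_u_castSucc] at e
    exact FreeGroup.map_injective (Fin.castSucc_injective n) e

/-- The round block word `x_a ⋯ x_b` with `b < n` is the same word one level up. [folklore] -/
theorem blockWord_succ {a b : ℕ} (hb : b < n) :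
    blockWord (n + 1) a b = FreeGroup.map Fin.castSucc (blockWord n a b) := by
  unfold blockWord
  have h1 : ([Fin.last n].filter fun i : Fin (n + 1) => decide (a ≤ i.val ∧ i.val ≤ b)) = [] := by
    simp only [List.filter_cons, Fin.val_last, List.filter_nil]
    rw [if_neg]
    simp only [decide_eq_true_eq, not_and, not_le]
    intro; exact hb
  rw [List.finRange_succ_last, List.filter_append, h1, List.append_nil, List.filter_map,
    map_list_prod, List.map_map, List.map_map]
  congr 1

/-- A generator supported below the hole `n` has, on `n + 1` holes, the lifted arc data.
[folklore] -/
theorem data_succ (x : PGen) (hx : x.below n = true) : data (n + 1) x = lift (data n x) := by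
  cases x with
  | sigma j s =>
    have hj : j + 1 < n := by simpa [PGen.below] using hx
    have hj' : j + 1 < n + 1 := by omega
    have e0 : (⟨j, by omega⟩ : Fin (n + 1)) = Fin.castSucc ⟨j, by omega⟩ := rfl
    have e1 : (⟨j + 1, hj'⟩ : Fin (n + 1)) = Fin.castSucc ⟨j + 1, hj⟩ := rfl
    simp only [data, hj, hj', ↓reduceDIte]
    refine ext' ?_ fun i => ?_
    · ext i
      cases i using Fin.lastCases with
      | last =>
        rw [lift_perm_last, Equiv.swap_apply_of_ne_of_ne]
        · exact Fin.ne_of_val_ne (by simp; omega)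
        · exact Fin.ne_of_val_ne (by simp; omega)
      | cast k =>
        rw [lift_perm_castSucc, e0, e1, (Fin.castSucc_injective n).map_swap]
    · cases i using Fin.lastCases with
      | last =>
        have h0 : (Fin.last n) ≠ (⟨j, by omega⟩ : Fin (n + 1)) := Fin.ne_of_val_ne (by simp; omega)
        have h1 : (Fin.last n) ≠ (⟨j + 1, hj'⟩ : Fin (n + 1)) := Fin.ne_of_val_ne (by simp; omega)
        rw [lift_u_last]
        cases s <;> simp [h0, h1]
      | cast k =>
        have c0 : (Fin.castSucc k = (⟨j, by omega⟩ : Fin (n + 1))) ↔ (k = ⟨j, by omega⟩) := by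
          simp [Fin.ext_iff]
        have c1 : (Fin.castSucc k = (⟨j + 1, hj'⟩ : Fin (n + 1))) ↔ (k = ⟨j + 1, hj⟩) := by
          simp [Fin.ext_iff]
        rw [lift_u_castSucc]
        cases s <;> simp only [c0, c1, Bool.false_eq_true, ↓reduceIte] <;> split_ifs <;>
          simp [FreeGroup.map.of]
  | round a b s =>
    have hb : b < n := by simpa [PGen.below] using hx
    refine ext' ?_ fun i => ?_
    · ext i
      cases i using Fin.lastCases <;> simp [data]
    · cases i using Fin.lastCases with
      | last =>
        rw [lift_u_last, round_u, if_neg]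
        simp only [Fin.val_last, not_and, not_le]
        intro; exact hb
      | cast k =>
        rw [lift_u_castSucc, round_u, round_u, Fin.val_castSucc]
        split_ifs <;> simp [blockWord_succ hb]

/-- A word supported below the hole `n` evaluates, on `n + 1` holes, to the lifted arc data.
[folklore] -/
theorem evalWord_succ (g : List PGen) (hg : ∀ x ∈ g, x.below n = true) :
    evalWord (n + 1) g = lift (evalWord n g) := by
  induction g with
  | nil => rw [evalWord_nil, evalWord_nil, lift_one]
  | cons p g ih =>
    rw [evalWord_cons, evalWord_cons, data_succ p (hg p (by simp)),
      ih (fun x hx => hg x (by simp [hx])), lift_mul]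

/-- The monodromy of an in-range signed word, re-read on `n + 1` holes, is the lifted monodromy.
[folklore] -/
theorem monodromy_succ (w : List Letter) (hw : ∀ l ∈ w, l.1.InRange n) :
    monodromy (n + 1) w = lift (monodromy n w) := by
  unfold monodromy
  refine evalWord_succ _ fun x hx => ?_
  simp only [List.mem_flatMap] at hx
  obtain ⟨l, hl, hx⟩ := hx
  exact twist_below (hw l hl) l.2 x hx

/-- (De)stabilisation bookkeeping: an in-range word has total monodromy `1` on `n + 1` holes iff
it has total monodromy `1` on `n` holes. [folklore] -/
theorem monodromy_succ_eq_one_iff (w : List Letter) (hw : ∀ l ∈ w, l.1.InRange n) :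
    monodromy (n + 1) w = one ↔ monodromy n w = one := by
  rw [monodromy_succ w hw, ← lift_one, lift_injective.eq_iff]

/-! ## The invariant "total monodromy `= 1`" along the moves and the orbit -/

/-- Every move preserves "total monodromy `= 1`", in both directions. [folklore] -/
theorem move_iff {s t : ℕ × List Letter} (h : Move s t) :
    (monodromy s.1 s.2 = one ↔ monodromy t.1 t.2 = one) := by
  cases h with
  | rotate n l w =>
    dsimp only
    rw [monodromy_eq_one_iff, monodromy_eq_one_iff, M_cons, M_append, M_cons, M_nil, mul_one]
    exact mul_eq_one_comm
  | hurwitz n pre post x y =>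
    dsimp only
    have e : M n (pre ++ hurwitzAct x y :: x :: post) = M n (pre ++ x :: y :: post) := by
      simp only [M_append, M_cons, T_hurwitzAct]
      group
    rw [monodromy_eq_one_iff, monodromy_eq_one_iff, e]
  | hurwitzInv n pre post x y =>
    obtain ⟨d, s⟩ := y
    dsimp only
    have e : M n (pre ++ (d, s) :: hurwitzAct (d, !s) x :: post)
        = M n (pre ++ x :: (d, s) :: post) := by
      simp only [M_append, M_cons, T_hurwitzAct, T_not]
      group
    rw [monodromy_eq_one_iff, monodromy_eq_one_iff, e]
  | conj n g w =>
    dsimp only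
    rw [monodromy_eq_one_iff, monodromy_eq_one_iff, M_map_image, conj_eq_one_iff]
  | stabilize n m g w hm hg hw =>
    dsimp only
    have e : M (n + 1) (((⟨m, n, g⟩, true) : Letter) :: ((⟨m, n, g⟩, false) : Letter) :: w)
        = M (n + 1) w := by
      rw [M_cons, M_cons, T_false, mul_inv_cancel_left]
    rw [← monodromy_succ_eq_one_iff w hw, monodromy_eq_one_iff, monodromy_eq_one_iff, e]

/-- "Total monodromy `= 1`" is an invariant of the orbit `Reachable` (moves and their inverses).
[folklore] -/
theorem reachable_iff {s t : ℕ × List Letter} (h : Reachable s t) :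
    (monodromy s.1 s.2 = one ↔ monodromy t.1 t.2 = one) := by
  unfold Reachable at h
  induction h with
  | refl => exact Iff.rfl
  | tail _ hbc ih => exact ih.trans (hbc.elim move_iff fun h' => (move_iff h').symm)

end ReachMon

/-- **Helper of line Sketch (v2.0) — reachable block forms again factorise ONE mapping class.**
For an integral homotopy-sphere word `(n; A, B)` the block form `A · B̄ʳᵉᵛ` has total monodromy
`φ_A φ_B⁻¹ = 1` (`monodromy_eq`); every move of the walk (rotation, signed Hurwitz move and its
inverse, global conjugation, planar (de)stabilisation — in either direction) keeps the total
monodromy trivial (`ReachMon.reachable_iff`: literal bookkeeping in the group of units of the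
on-the-nose monoid `ArcData n`, and the injective level embedding `ReachMon.lift` for the change of
the number of holes); so at every reachable block form `(n'; A', B')` again `φ_{A'} φ_{B'}⁻¹ = 1`,
i.e. `φ_{A'} = φ_{B'}`. [folklore] -/
theorem helper_reachable_monodromy_eq (n n' : ℕ) (A B A' B' : List PlanarCurve)
    (hw : IsIntegralSphereWord n A B)
    (hr : Reachable (n, blockForm A B) (n', blockForm A' B')) :
    monodromy n' (positiveWord A') = monodromy n' (positiveWord B') :=
  (ReachMon.blockForm_one_iff A' B').1
    ((ReachMon.reachable_iff hr).1 ((ReachMon.blockForm_one_iff A B).2 hw.monodromy_eq))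

end Summit.SmoothPoincare4.SmoothPoincare4.Theorems.PlanarAcyclicBisectionRigidity.Sketch

end
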